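import Literature.RepresentationTheory.FiniteGroups.EquivOfCharacter
import Literature.RepresentationTheory.FiniteGroups.BrauerInduction
import Literature.GroupTheory.ArithmeticGroups.SelbergLemma
import Mathlib.LinearAlgebra.Matrix.GeneralLinearGroup.Defs
import Mathlib.LinearAlgebra.Matrix.ToLin
import Mathlib.LinearAlgebra.Trace
import HarnessLib

/-!
# A compatible family of characters of finite groups is realised over a finite field, with traces separated

Topic `Literature/RepresentationTheory/FiniteGroups`; theorems only (no definition, no named fact).

Let `φ_i : H → G_i` (`i ∈ ι` finite) be homomorphisms of finite groups and `ψ_i` characters of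
`G_i` (`IsCharacter`) which are **compatible**: `ψ_i ∘ φ_i = ψ_j ∘ φ_j`.  Then

* `exists_representations_comp_eq` — the `ψ_i` are the characters of representations `ρ_i` of the
  `G_i` on ONE finite-dimensional complex space `V` which AGREE on `H`: `ρ_i (φ_i h) = ρ_j (φ_j h)`
  (Serre §2.3 Cor. 2 "a representation is determined by its character", the tree's
  `Representation.nonempty_equiv_of_character_eq`, applied to the restrictions to `H` and used to
  transport every `ρ_i` to the space of `ρ_{i₀}`);
* `exists_hom_generalLinearGroup_finite_not_isConj` — if moreover `ψ_{i₀}(x) ≠ ψ_{j₀}(y)`, there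
  are a FINITE field `k`, an `n`, and homomorphisms `f_i : G_i → GL_n(k)` agreeing on `H` with
  `f_{i₀}(x)` and `f_{j₀}(y)` NOT conjugate in `GL_n(k)` (their traces differ).  Proof: the
  subgroup of `GL(V) ≅ GL_n(ℂ)` generated by the (finite) images `ρ_i(G_i)` is finitely generated,
  hence lies in `GL_n(L)` for a finitely generated subring `L ⊂ ℂ` (the tree's
  `Literature.GroupTheory.ArithmeticGroups.exists_fg_subalgebra_le_range`, Serre's proof of
  Selberg's lemma); with `δ = ψ_{i₀}(x) - ψ_{j₀}(y) ∈ L ∖ 0`, the finitely generated ring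
  `L' = L[δ⁻¹]` has a maximal ideal `𝔪`, the field `k = L'/𝔪` is finite (Zariski's lemma over `ℤ`,
  the tree's `finite_quotient_of_isMaximal`), and `δ` is a unit of `L'`, so the traces of the
  reductions of `f_{i₀}(x)`, `f_{j₀}(y)` still differ in `k`;
* `exists_hom_finite_group_not_isConj` — the same with an abstract finite group `Q` and
  `f_i : G_i →* Q`.

This is the "trace" device for separating conjugacy classes of TORSION elements in finite quotients
(B. Fine, G. Rosenberger, *Conjugacy separability of Fuchsian groups and related questions*,
Contemp. Math. 109 (1990), for elements of finite order via a faithful linear representation;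
here for amalgams of finite groups, towards J. L. Dyer's theorem, J. Austral. Math. Soc. A 29 (1980)
Thm. 1).  Combined with `AmalgamCompatibleCharacters` it yields: two elements of the factors of an
amalgam of finite groups that are not related by conjugacy inside the factors and the identifications
along `H` have non-conjugate images in a finite quotient of the amalgam
(`Literature/GroupTheory/CombinatorialGroupTheory/FiniteAmalgamTorsionPairs.lean`).

## References

* J. L. Dyer, *Separating conjugates in amalgamated free products and HNN extensions*, J. Austral.
  Math. Soc. Ser. A 29 (1980) 35–51, Thm. 1. [Dyer1980]
* J.-P. Serre, *Linear Representations of Finite Groups*, GTM 42 (1977), §2.3 Cor. 2.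
  [SerreLinearRepresentations1977]
* J.-P. Serre, *Bounds for the orders of the finite subgroups of `G(k)`* (2007), Lect. I §1.2
  (reduction of a finitely generated linear group modulo a maximal ideal).
  [Serre2007BoundsFiniteSubgroups]
-/

noncomputable section

open scoped MatrixGroups

namespace Literature.RepresentationTheory.FiniteGroups

universe u

variable {ι : Type} [Fintype ι] {G : ι → Type} [∀ i, Group (G i)] [∀ i, Fintype (G i)]
  {H : Type} [Group H] [Fintype H]

/-! ### Realisation on one space, agreeing on `H` -/

omit [Fintype ι] [∀ i, Fintype (G i)] in
/-- **Compatible characters come from representations on one space agreeing on `H`.**  If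
`ψ_i` are characters of the finite groups `G_i` with `ψ_i ∘ φ_i = ψ_j ∘ φ_j` for homomorphisms
`φ_i : H → G_i`, then (for `ι` nonempty) there are a finite-dimensional complex space `V` and
representations `ρ_i : G_i → GL(V)` with characters `ψ_i` such that `ρ_i ∘ φ_i = ρ_j ∘ φ_j`.  By
Serre §2.3 Cor. 2 (the tree's `Representation.nonempty_equiv_of_character_eq`) the restrictions to
`H` of any realisations are equivalent, and one transports along the equivalences.
[cite: SerreLinearRepresentations1977, §2.3 Cor. 2] -/
theorem exists_representations_comp_eq (φ : ∀ i, H →* G i) (ψ : ∀ i, G i → ℂ)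
    (hψ : ∀ i, IsCharacter (G i) (ψ i)) (hcompat : ∀ i j, ψ i ∘ φ i = ψ j ∘ φ j) (i₀ : ι) :
    ∃ (V : Type) (_ : AddCommGroup V) (_ : Module ℂ V) (_ : FiniteDimensional ℂ V)
      (ρ : ∀ i, Representation ℂ (G i) V),
      (∀ i, (ρ i).character = ψ i) ∧ ∀ i j (h : H), ρ i (φ i h) = ρ j (φ j h) := by
  choose V instA instM instF ρ hρ using hψ
  -- restrictions to `H` have the same character, hence are equivalent to the one of `i₀`
  have hres : ∀ i, Representation.character (((ρ i₀).comp (φ i₀) : Representation ℂ H (V i₀))) =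
      Representation.character (((ρ i).comp (φ i) : Representation ℂ H (V i))) := by
    intro i
    funext h
    have := congrFun (hcompat i₀ i) h
    simp only [Function.comp_apply] at this
    change (ρ i₀).character (φ i₀ h) = (ρ i).character (φ i h)
    rw [hρ, hρ, this]
  have he : ∀ i, Nonempty (Representation.Equiv ((ρ i₀).comp (φ i₀) : Representation ℂ H (V i₀))
      ((ρ i).comp (φ i) : Representation ℂ H (V i))) :=
    fun i => Literature.RepresentationTheory.FiniteGroups.Representation.nonempty_equiv_of_character_eq
      _ _ (hres i)
  let e := fun i => Classical.choice (he i)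
  -- transport `ρ i` to `V i₀` along `e i`
  let E : ∀ i, V i₀ ≃ₗ[ℂ] V i := fun i => (e i).toLinearEquiv
  have hE : ∀ i (h : H) (v : V i₀), E i (ρ i₀ (φ i₀ h) v) = ρ i (φ i h) (E i v) := fun i h v =>
    Representation.IntertwiningMap.isIntertwining _ _ (e i).toIntertwiningMap h v
  let ρ' : ∀ i, Representation ℂ (G i) (V i₀) := fun i =>
    { toFun := fun g => (E i).symm.conj (ρ i g)
      map_one' := by rw [map_one]; exact LinearEquiv.conj_id _
      map_mul' := fun g g' => by
        simp only [map_mul, Module.End.mul_eq_comp, LinearEquiv.conj_comp] }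
  refine ⟨V i₀, instA i₀, instM i₀, instF i₀, ρ', fun i => ?_, fun i j h => ?_⟩
  · funext g
    change LinearMap.trace ℂ _ ((E i).symm.conj (ρ i g)) = ψ i g
    rw [LinearMap.trace_conj', ← hρ i]
    rfl
  · -- both sides equal `ρ i₀ (φ i₀ h)`
    have key : ∀ i, ρ' i (φ i h) = ρ i₀ (φ i₀ h) := by
      intro i
      change (E i).symm.conj (ρ i (φ i h)) = ρ i₀ (φ i₀ h)
      apply LinearMap.ext
      intro v
      rw [LinearEquiv.conj_apply_apply, LinearEquiv.symm_symm, LinearEquiv.symm_apply_eq, hE]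
    rw [key, key]

/-! ### From a common realisation to a finite field -/

/-- Injectivity of `GL_n(L) → GL_n(ℂ)` for a subring `L ⊆ ℂ`. [folklore] -/
private theorem generalLinearGroup_map_val_injective {n : Type} [Fintype n] [DecidableEq n]
    (L : Subalgebra ℤ ℂ) :
    Function.Injective (Matrix.GeneralLinearGroup.map (n := n) (L.val : L →ₐ[ℤ] ℂ).toRingHom) := by
  intro a b hab
  apply Units.ext
  have h := congrArg (fun u : GL n ℂ => (u : Matrix n n ℂ)) hab
  refine Matrix.map_injective (f := ((L.val : L →ₐ[ℤ] ℂ).toRingHom : L → ℂ))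
    Subtype.val_injective ?_
  simpa [Matrix.GeneralLinearGroup.map] using h

omit [Fintype H] in
/-- **Separating traces survive in a finite quotient.**  Let `ρ_i : G_i → GL(V)` be representations
of finite groups on one finite-dimensional complex space, agreeing on `H`
(`ρ_i (φ_i h) = ρ_j (φ_j h)`), and suppose `tr ρ_{i₀}(x) ≠ tr ρ_{j₀}(y)`.  Then there are a finite
field `k`, an `n` and homomorphisms `f_i : G_i → GL_n(k)` agreeing on `H` with `f_{i₀}(x)`,
`f_{j₀}(y)` not conjugate in `GL_n(k)`: the finitely generated linear group `⟨ρ_i(G_i)⟩` lies in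
`GL_n(L)` for a finitely generated ring `L ⊂ ℂ` (Serre 2007, Lect. I §1.2), and one reduces modulo
a maximal ideal of `L[δ⁻¹]`, `δ` the difference of the two traces, whose residue field is finite.
[cite: Serre2007BoundsFiniteSubgroups, Lect. I §1.2] -/
theorem exists_hom_generalLinearGroup_finite_not_isConj_of_representations (φ : ∀ i, H →* G i)
    {V : Type} [AddCommGroup V] [Module ℂ V] [FiniteDimensional ℂ V]
    (ρ : ∀ i, Representation ℂ (G i) V) (hcompat : ∀ i j (h : H), ρ i (φ i h) = ρ j (φ j h))
    {i₀ j₀ : ι} {x : G i₀} {y : G j₀}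
    (hne : LinearMap.trace ℂ V (ρ i₀ x) ≠ LinearMap.trace ℂ V (ρ j₀ y)) :
    ∃ (k : Type) (_ : Field k) (_ : Fintype k) (n : ℕ) (f : ∀ i, G i →* GL (Fin n) k),
      (∀ i j, (f i).comp (φ i) = (f j).comp (φ j)) ∧ ¬ IsConj (f i₀ x) (f j₀ y) := by
  classical
  -- Step 1: matrices.
  set n := Module.finrank ℂ V with hn
  let b := Module.finBasis ℂ V
  let τ : ∀ i, G i →* Matrix (Fin n) (Fin n) ℂ := fun i =>
    { toFun := fun g => LinearMap.toMatrix b b (ρ i g)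
      map_one' := by rw [map_one]; exact LinearMap.toMatrix_one b
      map_mul' := fun g g' => by rw [map_mul]; exact LinearMap.toMatrix_mul b _ _ }
  let τGL : ∀ i, G i →* GL (Fin n) ℂ := fun i => (τ i).toHomUnits
  have hτGL_coe : ∀ i (g : G i), ((τGL i g : GL (Fin n) ℂ) : Matrix (Fin n) (Fin n) ℂ) =
      LinearMap.toMatrix b b (ρ i g) := fun _ _ => rfl
  have htrace : ∀ i (g : G i), Matrix.trace (LinearMap.toMatrix b b (ρ i g)) =
      LinearMap.trace ℂ V (ρ i g) := fun i g => (LinearMap.trace_eq_matrix_trace ℂ b _).symm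
  -- Step 2: the subgroup generated by all `τGL i (G i)` is finitely generated, hence in `GL_n(L)`.
  set S : Set (GL (Fin n) ℂ) := ⋃ i, Set.range (τGL i) with hS_def
  have hSfin : S.Finite := Set.finite_iUnion fun i => Set.finite_range _
  set Γ : Subgroup (GL (Fin n) ℂ) := Subgroup.closure S with hΓ_def
  have hΓfg : Γ.FG := ⟨hSfin.toFinset, by rw [Set.Finite.coe_toFinset]⟩
  have hmemΓ : ∀ i (g : G i), τGL i g ∈ Γ := fun i g =>
    Subgroup.subset_closure (Set.mem_iUnion.mpr ⟨i, Set.mem_range_self g⟩)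
  obtain ⟨L, hLfg, hΓL⟩ :=
    Literature.GroupTheory.ArithmeticGroups.exists_fg_subalgebra_le_range Γ hΓfg
  set jL := Matrix.GeneralLinearGroup.map (n := Fin n) (L.val : L →ₐ[ℤ] ℂ).toRingHom with hjL
  have hjL_inj : Function.Injective jL := generalLinearGroup_map_val_injective L
  have hmem_range : ∀ i (g : G i), τGL i g ∈ jL.range := fun i g => hΓL (hmemΓ i g)
  -- lift each `τGL i` to `GL_n(L)`
  let σ : ∀ i, G i →* GL (Fin n) L := fun i =>
    (MonoidHom.ofInjective hjL_inj).symm.toMonoidHom.comp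
      ((τGL i).codRestrict jL.range (hmem_range i))
  have hσ : ∀ i (g : G i), jL (σ i g) = τGL i g := by
    intro i g
    change jL ((MonoidHom.ofInjective hjL_inj).symm ⟨τGL i g, hmem_range i g⟩) = τGL i g
    rw [MonoidHom.apply_ofInjective_symm]
  have hσ_entry : ∀ i (g : G i) (a c : Fin n),
      (((σ i g : GL (Fin n) L) : Matrix (Fin n) (Fin n) L) a c : ℂ) =
        LinearMap.toMatrix b b (ρ i g) a c := by
    intro i g a c
    have := congrArg (fun u : GL (Fin n) ℂ => (u : Matrix (Fin n) (Fin n) ℂ) a c) (hσ i g)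
    simpa [hjL, hτGL_coe] using this
  have hσ_compat : ∀ i j (h : H), σ i (φ i h) = σ j (φ j h) := by
    intro i j h
    apply hjL_inj
    rw [hσ, hσ]
    apply Units.ext
    rw [hτGL_coe, hτGL_coe, hcompat i j h]
  -- Step 3: the difference of traces `δ ∈ L`, non-zero.
  set δ : L := Matrix.trace ((σ i₀ x : GL (Fin n) L) : Matrix (Fin n) (Fin n) L) -
    Matrix.trace ((σ j₀ y : GL (Fin n) L) : Matrix (Fin n) (Fin n) L) with hδ_def
  have htrL : ∀ i (g : G i),
      ((Matrix.trace ((σ i g : GL (Fin n) L) : Matrix (Fin n) (Fin n) L) : L) : ℂ) =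
        LinearMap.trace ℂ V (ρ i g) := by
    intro i g
    rw [← htrace]
    change (L.val : L →ₐ[ℤ] ℂ) (Matrix.trace _) = _
    rw [AddMonoidHom.map_trace (L.val : L →ₐ[ℤ] ℂ)]
    congr 1
    ext a c
    exact hσ_entry i g a c
  have hδC : (δ : ℂ) = LinearMap.trace ℂ V (ρ i₀ x) - LinearMap.trace ℂ V (ρ j₀ y) := by
    rw [hδ_def, AddSubgroupClass.coe_sub, htrL, htrL]
  have hδ : (δ : ℂ) ≠ 0 := by rw [hδC]; exact sub_ne_zero.mpr hne
  -- Step 4: the ring `L' = L[δ⁻¹]`, finitely generated, with a maximal ideal `𝔪`; `k = L'/𝔪`.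
  obtain ⟨T, hT⟩ := hLfg
  set L' : Subalgebra ℤ ℂ := Algebra.adjoin ℤ (↑T ∪ {((δ : ℂ))⁻¹}) with hL'_def
  have hLL' : L ≤ L' := by
    rw [← hT, hL'_def]
    exact Algebra.adjoin_mono Set.subset_union_left
  have hL'fg : L'.FG := ⟨T ∪ {((δ : ℂ))⁻¹}, by rw [Finset.coe_union, Finset.coe_singleton]⟩
  haveI : Algebra.FiniteType ℤ L' := L'.fg_iff_finiteType.mp hL'fg
  have hinv_mem : ((δ : ℂ))⁻¹ ∈ L' :=
    Algebra.subset_adjoin (Set.mem_union_right _ (Set.mem_singleton _))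
  obtain ⟨𝔪, h𝔪⟩ := Ideal.exists_maximal L'
  haveI := h𝔪
  letI : Field (L' ⧸ 𝔪) := Ideal.Quotient.field 𝔪
  haveI : Finite (L' ⧸ 𝔪) :=
    Literature.GroupTheory.ArithmeticGroups.finite_quotient_of_isMaximal 𝔪
  letI : Fintype (L' ⧸ 𝔪) := Fintype.ofFinite _
  -- the reduction map `π : L → L' → L'/𝔪`
  set π : L →+* L' ⧸ 𝔪 := (Ideal.Quotient.mk 𝔪).comp (Subalgebra.inclusion hLL').toRingHom
    with hπ_def
  have hπδ : π δ ≠ 0 := by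
    intro h0
    have hunit : (Subalgebra.inclusion hLL' δ) * ⟨((δ : ℂ))⁻¹, hinv_mem⟩ = 1 := by
      apply Subtype.ext
      change (δ : ℂ) * ((δ : ℂ))⁻¹ = 1
      exact mul_inv_cancel₀ hδ
    have := congrArg (Ideal.Quotient.mk 𝔪) hunit
    rw [map_mul, map_one] at this
    have h0' : Ideal.Quotient.mk 𝔪 (Subalgebra.inclusion hLL' δ) = 0 := h0
    rw [h0', zero_mul] at this
    exact zero_ne_one this
  -- Step 5: the homomorphisms `f i = GL_n(π) ∘ σ i`.
  refine ⟨L' ⧸ 𝔪, inferInstance, inferInstance, n,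
    fun i => (Matrix.GeneralLinearGroup.map π).comp (σ i), fun i j => ?_, fun hconj => ?_⟩
  · ext h : 1
    simp only [MonoidHom.comp_apply, hσ_compat i j h]
  · -- conjugate matrices have the same trace
    obtain ⟨c, hc⟩ := isConj_iff.mp hconj
    have htr : Matrix.trace (((Matrix.GeneralLinearGroup.map π) (σ i₀ x) : GL (Fin n) (L' ⧸ 𝔪)) :
        Matrix (Fin n) (Fin n) (L' ⧸ 𝔪)) =
        Matrix.trace (((Matrix.GeneralLinearGroup.map π) (σ j₀ y) : GL (Fin n) (L' ⧸ 𝔪)) :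
        Matrix (Fin n) (Fin n) (L' ⧸ 𝔪)) := by
      simp only [MonoidHom.comp_apply] at hc
      rw [← hc, Units.val_mul, Units.val_mul, Matrix.trace_mul_cycle, Units.inv_mul, one_mul]
    apply hπδ
    rw [hδ_def, map_sub, sub_eq_zero]
    have hmap : ∀ i (g : G i),
        π (Matrix.trace ((σ i g : GL (Fin n) L) : Matrix (Fin n) (Fin n) L)) =
        Matrix.trace (((Matrix.GeneralLinearGroup.map π) (σ i g) : GL (Fin n) (L' ⧸ 𝔪)) :
          Matrix (Fin n) (Fin n) (L' ⧸ 𝔪)) := by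
      intro i g
      rw [AddMonoidHom.map_trace π]
      rfl
    rw [hmap, hmap, htr]

/-- **Compatible characters with a separating value are realised in `GL_n` of a finite field with
the separation preserved.**  For characters `ψ_i` of finite groups `G_i`, compatible along
`φ_i : H → G_i`, with `ψ_{i₀}(x) ≠ ψ_{j₀}(y)`, there are a finite field `k`, an `n` and
homomorphisms `f_i : G_i → GL_n(k)` agreeing on `H` with `f_{i₀}(x)`, `f_{j₀}(y)` not conjugate.
[cite: Dyer1980, Thm 1 p.36] -/
theorem exists_hom_generalLinearGroup_finite_not_isConj (φ : ∀ i, H →* G i) (ψ : ∀ i, G i → ℂ)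
    (hψ : ∀ i, IsCharacter (G i) (ψ i)) (hcompat : ∀ i j, ψ i ∘ φ i = ψ j ∘ φ j)
    {i₀ j₀ : ι} {x : G i₀} {y : G j₀} (hne : ψ i₀ x ≠ ψ j₀ y) :
    ∃ (k : Type) (_ : Field k) (_ : Fintype k) (n : ℕ) (f : ∀ i, G i →* GL (Fin n) k),
      (∀ i j, (f i).comp (φ i) = (f j).comp (φ j)) ∧ ¬ IsConj (f i₀ x) (f j₀ y) := by
  obtain ⟨V, _, _, _, ρ, hρ, hcomp⟩ := exists_representations_comp_eq φ ψ hψ hcompat i₀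
  refine exists_hom_generalLinearGroup_finite_not_isConj_of_representations φ ρ hcomp ?_
  change (ρ i₀).character x ≠ (ρ j₀).character y
  rw [hρ, hρ]
  exact hne

/-- The same with an abstract FINITE group as target: compatible characters with
`ψ_{i₀}(x) ≠ ψ_{j₀}(y)` give homomorphisms `f_i : G_i → Q`, `Q` finite, agreeing on `H`, with
`f_{i₀}(x)` and `f_{j₀}(y)` not conjugate in `Q`. [cite: Dyer1980, Thm 1 p.36] -/
theorem exists_hom_finite_group_not_isConj (φ : ∀ i, H →* G i) (ψ : ∀ i, G i → ℂ)
    (hψ : ∀ i, IsCharacter (G i) (ψ i)) (hcompat : ∀ i j, ψ i ∘ φ i = ψ j ∘ φ j)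
    {i₀ j₀ : ι} {x : G i₀} {y : G j₀} (hne : ψ i₀ x ≠ ψ j₀ y) :
    ∃ (Q : Type) (_ : Group Q) (_ : Finite Q) (f : ∀ i, G i →* Q),
      (∀ i j, (f i).comp (φ i) = (f j).comp (φ j)) ∧ ¬ IsConj (f i₀ x) (f j₀ y) := by
  obtain ⟨k, _, _, n, f, hf, hnc⟩ :=
    exists_hom_generalLinearGroup_finite_not_isConj φ ψ hψ hcompat hne
  exact ⟨GL (Fin n) k, inferInstance, inferInstance, f, hf, hnc⟩

end Literature.RepresentationTheory.FiniteGroups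

end
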